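import Summits.SmoothPoincare4.SmoothPoincare4.Theses.WeylBudget
import Literature.Topology.FourManifolds.CorkPresentationHomotopySphere
import Literature.Topology.FourManifolds.InvolutiveCorkDecomposition
import HarnessLib

/-!
# Stub A `stub_involutiveCorkPresentation` of line `registered` (crux `CorkRegluingBudget`),
# closed MODULO `Θ₄ = 0` and the cork decomposition theorem WITH INVOLUTION

Crux item stmt-SmoothPoincare4-10831 (`Summit.SmoothPoincare4.SmoothPoincare4.Theses.WeylBudget.CorkRegluingBudget`,
route `WeylBudget`), skeleton `Cruxes/CorkRegluingBudget/Lines/birth.lean`, Stub A (topology):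
every homotopy 4-sphere `Σ` is an INVOLUTIVE cork twist of the standard sphere with compact smooth
exterior — `S⁴ = C ∪_φ W`, `Σ = C ∪_{φ ∘ τ} W`, `C` compact contractible, `W` compact, `τ ∘ τ = id`.

In print this is Kirby's Corollary (R. Kirby, *Akbulut's corks and h-cobordisms of smooth, simply
connected 4-manifolds*, Turkish J. Math. 20 (1996), arXiv:math/9712231, p. 1: "Any homotopy
4-sphere, `Σ⁴`, can be constructed by cutting out a contractible 4-manifold, `A₀` from `S⁴` and
gluing it back in by an involution of `∂A₀`"), i.e. the cork decomposition theorem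
(Curtis–Freedman–Hsiang–Stong 1996; Matveyev 1996) with Kirby's Addendum (D) ("`A₀` is
diffeomorphic to `A₁` by a diffeomorphism which, restricted to `∂A₀ = ∂A₁`, is an involution
[mat95]", loc. cit. p. 1, proved in §5) applied to the h-cobordism `Σ ∼ S⁴` given by `Θ₄ = 0`
(Kervaire–Milnor 1963). WITHOUT the involution clause the stub is verbatim the conclusion of the
tree's proved `Literature.Topology.FourManifolds.HomotopySphere.exists_corkPresentation_of_facts`
(file `CorkPresentationHomotopySphere`), conditional on the two named facts
`Literature.Topology.FourManifolds.isHCobordant_sphere_of_homotopySphere_four` (`Θ₄ = 0`) and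
`Literature.Topology.FourManifolds.Matveyev1996_decomposition` (whose docstring, like that of
`Literature.Topology.FourManifolds.corkDecomposition`, explicitly OMITS the refinement "`τ` an
involution"). No involutive cork fact existed in the tree (searched `Involutive`, `involution`,
`cork` over `Literature/` and the stockroom, 2026-08-17): the involutive theorem appears only as the
HYPOTHESIS `hT` of
`Literature.Barriers.SmoothPoincare4.akbulut1991_notExtendsToDiffeomorph_of_involutiveCorkTheorem`.

An unconditional proof of Stub A is the cork theorem plus 5-dimensional h-cobordism input (XL, no
infrastructure in Mathlib or the tree: handle decompositions of h-cobordisms, Kirby calculus,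
boundary connected sums). Following the NEED-A-PUBLISHED-FACT rule this file therefore

* USES the cork decomposition theorem WITH INVOLUTION, stated by this line in the tree's gluing
  vocabulary and in the one-piece shape of `corkDecomposition` with the exterior's instances exposed
  (the shape of `hT` above and of this stub) as the named fact
  `Literature.Topology.FourManifolds.involutiveCorkDecomposition` — written inline in the first
  submission of this file and relocated by the gate to
  `Literature/Topology/FourManifolds/InvolutiveCorkDecomposition.lean` (p147235; Kirby 1996, Theorem
  and Addendum (D), arXiv:math/9712231 p. 1 and §5; Akbulut–Yasui 2008, Thm. 1.1, arXiv:0806.3010;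
  cf. Matveyev, arXiv:dg-ga/9505001, Theorem 1 and Fact 1 — sources read);
* PROVES the stub conditionally: `stub_involutiveCorkPresentation_of_facts hΘ hK : <Stub A verbatim>`
  for `hΘ : isHCobordant_sphere_of_homotopySphere_four` and `hK : involutiveCorkDecomposition`,
  along the lines of `exists_corkPresentation_of_facts` — `Σ` is simply connected (`π₁(S⁴) = 1`,
  `Literature.Topology.FourManifolds.simplyConnectedSpace_sphere_four_holds`, transported along
  `Σ ≃ₕ S⁴` by Mathlib's `ContinuousMap.HomotopyEquiv.simplyConnectedSpace`) and h-cobordant to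
  `S⁴` (`(hΘ Σ).symm`), so `hK` applied to `S⁴` and `Σ` is the stub (`Function.Involutive τ` is by
  definition `∀ z, τ (τ z) = z`).

The registered stub `stub_involutiveCorkPresentation` itself (no hypotheses) is NOT declared here and
stays open: it is exactly `stub_involutiveCorkPresentation_of_facts hΘ hK`, i.e. blocked on the named
facts `isHCobordant_sphere_of_homotopySphere_four` and `involutiveCorkDecomposition` (neither has a
`_holds`). Nothing here is shaped like the crux (which is about Riemannian metrics) or like SPC4.

## References

* R. Kirby, *Akbulut's corks and h-cobordisms of smooth, simply connected 4-manifolds*, Turkish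
  J. Math. 20 (1996) 85–93; arXiv:math/9712231, p. 1 (Theorem, Addenda (A)–(D), Corollary) and §5
  (proof of (D)). [KirbyCorks1996]
* S. Akbulut, K. Yasui, *Corks, plugs and exotic structures*, J. Gökova Geom. Topol. 2 (2008)
  40–82; arXiv:0806.3010, Thm. 1.1 and Def. 2.1. [AkbulutYasui2008]
* R. Matveyev, *A decomposition of smooth simply-connected h-cobordant 4-manifolds*,
  J. Differential Geom. 44 (1996) 571–582; arXiv:dg-ga/9505001, Theorem 1 and Fact 1. [Matveyev1996]
* C. L. Curtis, M. H. Freedman, W.-C. Hsiang, R. Stong, Invent. Math. 123 (1996) 343–348, Theorem.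
  [CurtisFreedmanHsiangStong1996]
* S. Akbulut, R. Matveyev, *A convex decomposition theorem for 4-manifolds*, IMRN 1998:7,
  371–381. [AkbulutMatveyev1998]
* M. Kervaire, J. Milnor, *Groups of homotopy spheres: I*, Ann. of Math. 77 (1963), table p. 504
  (`Θ₄ = 0`). [KervaireMilnorAnnals1963]
-/

-- the prescribed namespace `Summit.<S>.<P>.…` repeats `SmoothPoincare4` (S = P = SmoothPoincare4)
set_option linter.dupNamespace false

open scoped Manifold ContDiff Topology

noncomputable section

namespace Summit.SmoothPoincare4.SmoothPoincare4.Theorems.CorkRegluingBudget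

/-- **Stub A of line `registered` (`stub_involutiveCorkPresentation`, VERBATIM after the two
hypotheses, colon form `Θ₄ = 0 → involutive cork theorem → <Stub A>`; registered on the crux item as
the sub-goal `stub_involutiveCorkPresentation_of_facts`), conditional on `Θ₄ = 0` (`hΘ`,
Kervaire–Milnor 1963) and on the cork decomposition theorem with involution (`hK`, Kirby 1996
Theorem + Addendum (D) = Akbulut–Yasui 2008 Thm. 1.1).**
For every homotopy 4-sphere `Σ` there are a compact contractible smooth `C⁴` with boundary datum
`bC`, a compact smooth `W⁴` with boundary datum `bW` (both Hausdorff, second countable),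
`φ : ∂C ≅ ∂W` and an involution `τ` of `∂C` with `S⁴ = C ∪_φ W` and `Σ = C ∪_{φ ∘ τ} W` — Kirby's
Corollary (arXiv:math/9712231, p. 1). Proof (as `HomotopySphere.exists_corkPresentation_of_facts`):
`Σ` is simply connected (`π₁(S⁴) = 1` transported along `Σ ≃ₕ S⁴`) and h-cobordant to `S⁴`
(`Θ₄ = 0`), so `hK` applied to the pair `(S⁴, Σ)` gives the presentation; `Function.Involutive τ`
is `∀ z, τ (τ z) = z` by definition. Hence the registered stub is
`stub_involutiveCorkPresentation_of_facts hΘ hK` and stays open exactly on these two named facts.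
[cite: KirbyCorks1996, Corollary p. 1 and Addendum (D)] [cite: KervaireMilnorAnnals1963, table p. 504 (Θ₄ = 0)]
[cite: AkbulutYasui2008, Thm. 1.1] -/
theorem stub_involutiveCorkPresentation_of_facts :
    Literature.Topology.FourManifolds.isHCobordant_sphere_of_homotopySphere_four →
    Literature.Topology.FourManifolds.involutiveCorkDecomposition →
    ∀ S : Literature.Topology.FourManifolds.HomotopySphere 4,
      ∃ (C : Type) (_ : TopologicalSpace C) (_ : T2Space C) (_ : SecondCountableTopology C)
        (_ : ChartedSpace (EuclideanHalfSpace 4) C) (_ : IsManifold (𝓡∂ 4) ∞ C)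
        (_ : CompactSpace C) (_ : ContractibleSpace C)
        (bC : Literature.Topology.FourManifolds.BoundaryData (𝓡∂ 4) C (𝓡 3))
        (W : Type) (_ : TopologicalSpace W) (_ : T2Space W) (_ : SecondCountableTopology W)
        (_ : ChartedSpace (EuclideanHalfSpace 4) W) (_ : IsManifold (𝓡∂ 4) ∞ W)
        (_ : CompactSpace W)
        (bW : Literature.Topology.FourManifolds.BoundaryData (𝓡∂ 4) W (𝓡 3))
        (φ : bC.carrier ≃ₘ⟮𝓡 3, 𝓡 3⟯ bW.carrier) (τ : bC.carrier ≃ₘ⟮𝓡 3, 𝓡 3⟯ bC.carrier),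
        (∀ z, τ (τ z) = z) ∧
          Literature.Topology.FourManifolds.IsBoundaryGluing bC bW φ (𝓡 4)
              (Metric.sphere (0 : EuclideanSpace ℝ (Fin 5)) 1) ∧
            Literature.Topology.FourManifolds.IsBoundaryGluing bC bW (τ.trans φ) (𝓡 4) S.carrier := by
  intro hΘ hK S
  obtain ⟨e⟩ := S.nonempty_homotopyEquiv
  haveI : SimplyConnectedSpace (Metric.sphere (0 : EuclideanSpace ℝ (Fin 5)) 1) :=
    Literature.Topology.FourManifolds.simplyConnectedSpace_sphere_four_holds
  haveI : SimplyConnectedSpace S.carrier := e.simplyConnectedSpace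
  obtain ⟨C, _, _, _, _, _, _, _, bC, W, _, _, _, _, _, _, bW, φ, τ, hτ, h₁, h₂⟩ :=
    hK (Metric.sphere (0 : EuclideanSpace ℝ (Fin 5)) 1) S.carrier (hΘ S).symm
  exact ⟨C, ‹_›, ‹_›, ‹_›, ‹_›, ‹_›, ‹_›, ‹_›, bC, W, ‹_›, ‹_›, ‹_›, ‹_›, ‹_›, ‹_›, bW, φ, τ,
    fun z => hτ z, h₁, h₂⟩

end Summit.SmoothPoincare4.SmoothPoincare4.Theorems.CorkRegluingBudget

end
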